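import Literature.NumberTheory.QuadraticForms.QuadraticExtensionPlaces
import Literature.NumberTheory.NumberFields.AdicCompletionSquareCriteria
import Literature.NumberTheory.GaloisRepresentations.FrobeniusDensityTheorem
import HarnessLib

/-!
# A prime of degree one at which `d` is a non-zero square splits completely in `K(√d)`
# (the decomposition law of a quadratic extension at an odd unramified prime)

Topic `NumberTheory/NumberFields`; namespace `Literature.NumberTheory.NumberFields`. Theorems only
(no definition, no named fact), all fully proved. For a number field `K`, a quadratic extension
`E = K(α)`, `α² = θ ∈ K`, `α ∉ K` (`Algebra.IsQuadraticExtension K E`), and a finite place `v` of `K`: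

* `mem_splitPrimes_of_ncard_primesOver_eq_finrank` — in a Galois extension `M/K`, a prime with
  `[M : K]` primes above it splits completely (`e = f = 1` from `g·e·f = [M : K]`, Mathlib
  `Ideal.ncard_primesOver_mul_ramificationIdxIn_mul_inertiaDegIn`; the tree has this over `ℚ` as
  `splitsCompletely_of_ncard_primesOver_eq_finrank` and, inside the automorphic hierarchy, as
  `isUnramifiedIn_of_ncard_eq_finrank` — re-proved here in 15 lines to keep the imports light);
* `QuadraticExtension.mem_splitPrimes_of_isSquare_adicCompletion` — **if `θ` is a square in `K_v`
  then `v` splits completely in `E`** (two places above `v` by the tree's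
  `QuadraticExtension.ncard_finitePlacesOver_eq_two_of_isSquare`, O'Meara §65A, hence `e = f = 1`);
* `isSquare_adicCompletion_intCast_of_sq_sub_dvd` — **Hensel at an odd prime**: for `v ∣ ℓ`, `ℓ`
  odd, and an integer `d` with `ℓ ∣ x² - d`, `ℓ ∤ d` for some `x ∈ ℤ`, `d` is a square in `K_v`
  (the tree's `isSquare_adicCompletion_intCast_of_dvd_sub_one` is the case `x = 1`);
* `QuadraticExtension.mem_splitPrimes_of_isSquare_zmod` — **the decomposition law at a prime of
  degree one**: if `N v = ℓ` is an odd prime, `ℓ ∤ d` and `d` is a square modulo `ℓ`, then `v`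
  splits completely in `E = K(√d)` (Marcus, *Number Fields*, Thm. 25 for `K = ℚ`; Neukirch I (8.3)
  with Hensel II (4.6)).

These are the local inputs of the genus theory of ring class fields
(`EllipticCurves/RingClassFieldGenusProofs.lean`: `√d ∈ K[f]` for `|d| ∣ f`).

## References

* D. A. Marcus, *Number Fields*, 2nd ed. (2018), Ch. 3 Thm. 25; Ch. 4 (before Thm. 29).
  [Marcus2018]
* O. T. O'Meara, *Introduction to Quadratic Forms* (1963), §63A (63:1), §65A. [Omeara1963]
* J. Neukirch, *Algebraic Number Theory* (1999), Ch. I (8.3), Ch. II (4.6). [NeukirchANT1999]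
-/

noncomputable section

open scoped NumberField Valued
open NumberField IsDedekindDomain

namespace Literature.NumberTheory.NumberFields

open Literature.NumberTheory.GaloisRepresentations Literature.NumberTheory.Automorphic
open Literature.NumberTheory.QuadraticForms

/-! ### `[M : K]` primes above `v` means complete splitting -/

section Split

variable {K M : Type*} [Field K] [NumberField K] [Field M] [NumberField M] [Algebra K M]
  [IsGalois K M]

/-- In a Galois extension `M/K`, a prime `v` of `K` with `[M : K]` primes of `M` above it **splits
completely** (`g · e · f = [M : K]` forces `e = f = 1`; Marcus Ch. 4, before Thm. 29).
[cite: Marcus2018, Ch. 4 (before Thm. 29)] -/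
theorem mem_splitPrimes_of_ncard_primesOver_eq_finrank (v : HeightOneSpectrum (𝓞 K))
    (h : (v.asIdeal.primesOver (𝓞 M)).ncard = Module.finrank K M) :
    v ∈ splitPrimes K M := by
  have hid := Ideal.ncard_primesOver_mul_ramificationIdxIn_mul_inertiaDegIn v.asIdeal (𝓞 M)
    (M ≃ₐ[K] M)
  rw [IsGalois.card_aut_eq_finrank, ← h] at hid
  have hne : (v.asIdeal.primesOver (𝓞 M)).ncard ≠ 0 := by
    rw [h]
    exact Module.finrank_pos.ne'
  have hef : v.asIdeal.ramificationIdxIn (𝓞 M) * v.asIdeal.inertiaDegIn (𝓞 M) = 1 := by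
    have h' : (v.asIdeal.primesOver (𝓞 M)).ncard *
        (v.asIdeal.ramificationIdxIn (𝓞 M) * v.asIdeal.inertiaDegIn (𝓞 M)) =
        (v.asIdeal.primesOver (𝓞 M)).ncard * 1 := by rw [mul_one]; exact hid
    exact Nat.eq_of_mul_eq_mul_left (Nat.pos_of_ne_zero hne) h'
  have he : v.asIdeal.ramificationIdxIn (𝓞 M) = 1 := Nat.eq_one_of_mul_eq_one_right hef
  have hf : v.asIdeal.inertiaDegIn (𝓞 M) = 1 := Nat.eq_one_of_mul_eq_one_left hef
  refine ⟨?_, fun Q hQ => ?_⟩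
  · rw [Algebra.isUnramifiedIn_iff_forall_ramificationIdx_eq_one]
    intro P _ hP
    rw [← Ideal.ramificationIdxIn_eq_ramificationIdx v.asIdeal P (M ≃ₐ[K] M)]
    exact he
  · haveI := hQ.1
    haveI := hQ.2
    rw [← Ideal.inertiaDegIn_eq_inertiaDeg v.asIdeal Q (M ≃ₐ[K] M)]
    exact hf

end Split

/-! ### Hensel at an odd prime: a non-zero square residue lifts -/

section Hensel

variable {K : Type*} [Field K] [NumberField K]

/-- **A unit quadratic residue is a local square at an odd place**: for `v ∣ ℓ`, `ℓ` an odd prime,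
and `d ∈ ℤ` with `ℓ ∣ x² - d` for some integer `x` and `ℓ ∤ d`, the integer `d` is a square in
`K_v` (Hensel's lemma for `X² - d` at `x` in the Henselian ring `𝒪_v`, where `2x ∈ 𝒪_vˣ`;
O'Meara 63:1a, Neukirch II (4.6)). [cite: Omeara1963, §63A (63:1a)] -/
theorem isSquare_adicCompletion_intCast_of_sq_sub_dvd (v : HeightOneSpectrum (𝓞 K)) {ℓ : ℕ}
    (hℓ : ℓ.Prime) (hℓ2 : ℓ ≠ 2) (hℓv : ((ℓ : ℕ) : 𝓞 K) ∈ v.asIdeal) {d x : ℤ}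
    (hx : (ℓ : ℤ) ∣ x ^ 2 - d) (hd : ¬ (ℓ : ℤ) ∣ d) :
    IsSquare (algebraMap K (v.adicCompletion K) (d : K)) := by
  haveI : HenselianLocalRing 𝒪[v.adicCompletion K] :=
    inferInstanceAs (HenselianLocalRing (v.adicCompletionIntegers K))
  have hint : (Valued.v (R := v.adicCompletion K)).Integers 𝒪[v.adicCompletion K] :=
    Valuation.integer.integers _
  have hvalO : ∀ n : ℤ, Valued.v (((n : 𝒪[v.adicCompletion K]) : v.adicCompletion K)) =
      v.intValuation (n : 𝓞 K) := fun n => by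
    rw [← valued_intCast_adicCompletion v n]
    simp
  -- `ℓ ∈ 𝔪_v`; an integer prime to `ℓ` is a unit of `𝒪_v`
  have hℓm : (ℓ : 𝒪[v.adicCompletion K]) ∈ IsLocalRing.maximalIdeal 𝒪[v.adicCompletion K] := by
    rw [IsLocalRing.mem_maximalIdeal, mem_nonunits_iff, hint.isUnit_iff_valuation_eq_one]
    apply ne_of_lt
    change Valued.v ((((ℓ : 𝒪[v.adicCompletion K])) : v.adicCompletion K)) < 1
    rw [← Int.cast_natCast, hvalO, HeightOneSpectrum.intValuation_lt_one_iff_mem, Int.cast_natCast]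
    exact hℓv
  have hunit : ∀ n : ℤ, ¬ (ℓ : ℤ) ∣ n → IsUnit ((n : 𝒪[v.adicCompletion K])) := fun n hn => by
    rw [hint.isUnit_iff_valuation_eq_one]
    change Valued.v ((((n : 𝒪[v.adicCompletion K])) : v.adicCompletion K)) = 1
    rw [hvalO]
    exact HeightOneSpectrum.intValuation_eq_one_iff.2
      (fun h => hn ((intCast_mem_asIdeal_iff_of_natCast_mem hℓ v hℓv n).1 h))
  have hu2 : IsUnit (2 : 𝒪[v.adicCompletion K]) := by
    have h2 : ¬ (ℓ : ℤ) ∣ 2 := fun h22 => by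
      have : ℓ ∣ 2 := by exact_mod_cast h22
      exact hℓ2 ((Nat.prime_dvd_prime_iff_eq hℓ Nat.prime_two).1 this)
    have := hunit 2 h2
    simpa using this
  have hux : IsUnit ((x : 𝒪[v.adicCompletion K])) := by
    refine hunit x fun hℓx => hd ?_
    have h1 : (ℓ : ℤ) ∣ x ^ 2 := Dvd.dvd.pow hℓx two_ne_zero
    have h2 : (ℓ : ℤ) ∣ x ^ 2 - (x ^ 2 - d) := dvd_sub h1 hx
    simpa using h2
  -- Hensel at `z₀ = x`
  obtain ⟨k, hk⟩ := hx
  have hc : ((x : ℤ) : 𝒪[v.adicCompletion K]) ^ 2 - ((d : ℤ) : 𝒪[v.adicCompletion K]) ∈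
      IsLocalRing.maximalIdeal 𝒪[v.adicCompletion K] := by
    have h : ((x : ℤ) : 𝒪[v.adicCompletion K]) ^ 2 - ((d : ℤ) : 𝒪[v.adicCompletion K]) =
        ((ℓ : ℤ) : 𝒪[v.adicCompletion K]) * ((k : ℤ) : 𝒪[v.adicCompletion K]) := by
      have h' := congrArg (Int.cast : ℤ → 𝒪[v.adicCompletion K]) hk
      push_cast at h' ⊢
      exact h'
    rw [h]
    push_cast
    exact Ideal.mul_mem_right _ _ hℓm
  obtain ⟨z, hz⟩ := exists_sq_eq_of_sq_sub_mem_maximalIdeal hu2 hux hc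
  refine ⟨(z : v.adicCompletion K), ?_⟩
  have hz' : ((z : v.adicCompletion K)) ^ 2 = (d : v.adicCompletion K) := by
    have h := congrArg (fun t : 𝒪[v.adicCompletion K] => (t : v.adicCompletion K)) hz
    simpa using h
  rw [map_intCast, ← sq, hz']

end Hensel

/-! ### The decomposition law of `K(√θ)/K`: local squares split -/

namespace QuadraticExtension

variable {K E : Type*} [Field K] [Field E] [Algebra K E] [Algebra.IsQuadraticExtension K E]
  [NumberField K] [NumberField E] {θ : K} {α : E}

/-- **If `θ` is a square in `K_v` then `v` splits completely in `E = K(√θ)`**: there are two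
places of `E` above `v` (O'Meara §65A, the tree's
`QuadraticExtension.ncard_finitePlacesOver_eq_two_of_isSquare`), i.e. `[E : K] = 2` primes, so
`e = f = 1`. [cite: Omeara1963, §65A] -/
theorem mem_splitPrimes_of_isSquare_adicCompletion (hα : α ^ 2 = algebraMap K E θ)
    (hαK : ∀ r : K, algebraMap K E r ≠ α) (v : HeightOneSpectrum (𝓞 K))
    (hsq : IsSquare (algebraMap K (v.adicCompletion K) θ)) : v ∈ splitPrimes K E := by
  have h2 := QuadraticForms.QuadraticExtension.ncard_finitePlacesOver_eq_two_of_isSquare hα hαK v hsq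
  rw [ncard_finitePlacesOver_eq_ncard_primesOver] at h2
  refine mem_splitPrimes_of_ncard_primesOver_eq_finrank v ?_
  rw [h2, Algebra.IsQuadraticExtension.finrank_eq_two K E]

/-- **The decomposition law at a prime of degree one.** Let `E = K(α)` with `α² = d ∈ ℤ`, `α ∉ K`,
and let `v` be a prime of `K` of prime norm `N v = ℓ`, `ℓ` odd, `ℓ ∤ d`. If `d` is a square
modulo `ℓ` then `v` splits completely in `E` (the residue field of `v` is `𝔽_ℓ`, so `X² - d` has
a simple root modulo `v`, which lifts to `K_v` by Hensel; then there are two places above `v`).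
For `K = ℚ` this is Marcus, Thm. 25 ("if `(d/p) = 1` then `p𝒪 = P P'`").
[cite: Marcus2018, Ch. 3 Thm. 25] [cite: Omeara1963, §65A] -/
theorem mem_splitPrimes_of_isSquare_zmod {d : ℤ} (hα : α ^ 2 = algebraMap K E (d : K))
    (hαK : ∀ r : K, algebraMap K E r ≠ α) (v : HeightOneSpectrum (𝓞 K)) {ℓ : ℕ}
    (hℓ : ℓ.Prime) (hℓ2 : ℓ ≠ 2) (hN : Ideal.absNorm v.asIdeal = ℓ) (hℓd : ¬ (ℓ : ℤ) ∣ d)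
    (hsq : IsSquare ((d : ZMod ℓ))) : v ∈ splitPrimes K E := by
  -- `ℓ ∈ v` since `N v = ℓ`
  have hℓv : ((ℓ : ℕ) : 𝓞 K) ∈ v.asIdeal := by
    rw [← hN]
    exact Ideal.absNorm_mem v.asIdeal
  -- a square root of `d` modulo `ℓ` in `ℤ`
  haveI : NeZero ℓ := ⟨hℓ.ne_zero⟩
  obtain ⟨y, hy⟩ := hsq
  have hx : (ℓ : ℤ) ∣ (y.val : ℤ) ^ 2 - d := by
    rw [← ZMod.intCast_zmod_eq_zero_iff_dvd]
    push_cast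
    rw [ZMod.natCast_zmod_val, hy]
    ring
  exact mem_splitPrimes_of_isSquare_adicCompletion hα hαK v
    (isSquare_adicCompletion_intCast_of_sq_sub_dvd v hℓ hℓ2 hℓv hx hℓd)

end QuadraticExtension

end Literature.NumberTheory.NumberFields

end
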